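import Mathlib.Analysis.InnerProductSpace.Basic
import Mathlib.Analysis.SpecialFunctions.Pow.Real

/-!
# K1L_D (stmt-AnomalousDissipation-27980), §9d (Recin) = `stub_cellInputs_transfer`: the OPERATOR ALGEBRA of the six transfer bounds
(helper, `--supports 27980 --as helper`; prover ad-k1loc-p3 g8, TAKES #17, lead-k1l-onelevel-p1 g5's brief memo L14 / tenure D26-16)

Memo L14: in the loss-currency architecture the six transfer bounds (R1)–(R6) of §9d are algebra over three inputs on one grid window —
the STRONG form of the bilinear window error `‖(U − T)x‖ ≤ ηz·N(x)` (§9z tested with `y := (U − T)x`; `N ≤ ‖·‖`), the dissipation floor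
`N(y)² ≤ 2·q_T(y)` (W3-E (i) + off-ball saturation + zero mode), and the high-label kill `‖Q_i(T y)‖ ≤ ε₁‖y‖`, `‖T((Q₁+Q₂)y)‖ ≤ ε₁‖y‖` (W3-E (ii)
via (Hi)).  This file proves that algebra ONCE over an arbitrary real normed space (`U, T, Q` any maps with the stated bounds, `N` any functional):
* `norm_high_transfer_le` — (R3)/(R4)/(R5)/(R6) shape: `‖Q(U y)‖ ≤ ηz‖y‖ + ε₁‖y‖`;
* `lossFwd_part_le` — the loss of the low part is controlled by the total loss: `q_T(Pu) ≤ q_T(u) + 2ε₁‖u‖²` when `u = Pu + Ru`, `‖Pu‖ ≤ ‖u‖`,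
  `‖T Ru‖ ≤ ε₁‖u‖`, `T` a contraction;
* `sqrt_add_le'`, `norm_low_transfer_le` — (R1)/(R2) shape: `‖Q(U(Pu))‖ ≤ √(2ηz²·q_T(u)) + (ε₁ + 2ηz√ε₁)·‖u‖`.
Pure algebra; the instantiation with the K1L texts (`U = Um1 (jR) s′`, `T = Um (jR) s′`, label projectors, `N` = the dissipation-weighted norm) is the
companion file `…LagrangianStepCellInputsTransfer`.  NOT a proof of §9d's inputs, of `stub_cellInputs`, of K1L_D or of AD; rung F-D1.A0.
-/

set_option linter.dupNamespace false

noncomputable section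

namespace Summit.AnomalousDissipation.AnomalousDissipation.Theorems.SolenoidalFractalHomogenisation.LagrangianStep.Transfer

variable {H : Type*} [NormedAddCommGroup H]

/-- **(R3)–(R6) shape.**  If `Q` is a contraction, `Q ∘ T` is `ε₁`-small, `U − T` is `ηz`-small in the currency `N ≤ ‖·‖`, then
`‖Q(U y)‖ ≤ ηz‖y‖ + ε₁‖y‖`. [folklore] -/
theorem norm_high_transfer_le {U T Q : H → H} {N : H → ℝ} {ηz ε₁ : ℝ} (hηz : 0 ≤ ηz)
    (hQlin : ∀ a b : H, Q (a + b) = Q a + Q b) (hQ : ∀ z, ‖Q z‖ ≤ ‖z‖) (hHi : ∀ y, ‖Q (T y)‖ ≤ ε₁ * ‖y‖)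
    (hUT : ∀ x, ‖U x - T x‖ ≤ ηz * N x) (hN : ∀ y, N y ≤ ‖y‖) (y : H) :
    ‖Q (U y)‖ ≤ ηz * ‖y‖ + ε₁ * ‖y‖ := by
  have e : U y = T y + (U y - T y) := by abel
  rw [e, hQlin]
  calc ‖Q (T y) + Q (U y - T y)‖ ≤ ‖Q (T y)‖ + ‖Q (U y - T y)‖ := norm_add_le _ _
    _ ≤ ε₁ * ‖y‖ + ηz * N y := add_le_add (hHi y) ((hQ _).trans (hUT y))
    _ ≤ ε₁ * ‖y‖ + ηz * ‖y‖ := by nlinarith [hN y]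
    _ = ηz * ‖y‖ + ε₁ * ‖y‖ := add_comm _ _

/-- **The loss of a part is controlled by the total loss.**  `T` a contraction with `T u = T Pu + T Ru`, `‖Pu‖ ≤ ‖u‖`, `‖T Ru‖ ≤ ε₁‖u‖`,
`0 ≤ ε₁`: `‖Pu‖² − ‖T Pu‖² ≤ (‖u‖² − ‖T u‖²) + 2ε₁‖u‖²`. [folklore] -/
theorem lossFwd_part_le {T : H → H} {ε₁ : ℝ} (hε₁ : 0 ≤ ε₁) (hT : ∀ y, ‖T y‖ ≤ ‖y‖)
    {u Pu Ru : H} (hTu : T u = T Pu + T Ru) (hPu : ‖Pu‖ ≤ ‖u‖) (hTR : ‖T Ru‖ ≤ ε₁ * ‖u‖) :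
    ‖Pu‖ ^ 2 - ‖T Pu‖ ^ 2 ≤ (‖u‖ ^ 2 - ‖T u‖ ^ 2) + 2 * ε₁ * ‖u‖ ^ 2 := by
  have hTu_le : ‖T u‖ ≤ ‖T Pu‖ + ε₁ * ‖u‖ := by
    rw [hTu]; exact (norm_add_le _ _).trans (by linarith)
  have hu0 : 0 ≤ ‖u‖ := norm_nonneg _
  have hTu0 : 0 ≤ ‖T u‖ := norm_nonneg _
  have hTPu0 : 0 ≤ ‖T Pu‖ := norm_nonneg _
  have hTuu : ‖T u‖ ≤ ‖u‖ := hT u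
  -- `‖T u‖² ≤ ‖T Pu‖² + 2ε₁‖u‖²`
  have key : ‖T u‖ ^ 2 ≤ ‖T Pu‖ ^ 2 + 2 * ε₁ * ‖u‖ ^ 2 := by
    by_cases h : ε₁ * ‖u‖ ≤ ‖T u‖
    · have h1 : ‖T u‖ - ε₁ * ‖u‖ ≤ ‖T Pu‖ := by linarith
      have h2 : 0 ≤ ‖T u‖ - ε₁ * ‖u‖ := by linarith
      nlinarith [mul_le_mul h1 h1 h2 hTPu0, mul_nonneg hε₁ hu0]
    · have h' := not_le.mp h
      nlinarith [mul_nonneg hε₁ hu0, h', mul_le_mul_of_nonneg_left hTuu hTu0]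
  nlinarith [hPu, norm_nonneg Pu]

/-- `√(a + b) ≤ √a + √b` for `0 ≤ a, b` (private: the public name is landed elsewhere in the tree). [folklore] -/
private theorem sqrt_add_le' {a b : ℝ} (ha : 0 ≤ a) (hb : 0 ≤ b) : Real.sqrt (a + b) ≤ Real.sqrt a + Real.sqrt b := by
  have hs : 0 ≤ Real.sqrt a + Real.sqrt b := add_nonneg (Real.sqrt_nonneg _) (Real.sqrt_nonneg _)
  have hsq : a + b ≤ (Real.sqrt a + Real.sqrt b) ^ 2 := by
    nlinarith [Real.sq_sqrt ha, Real.sq_sqrt hb, mul_nonneg (Real.sqrt_nonneg a) (Real.sqrt_nonneg b)]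
  calc Real.sqrt (a + b) ≤ Real.sqrt ((Real.sqrt a + Real.sqrt b) ^ 2) := Real.sqrt_le_sqrt hsq
    _ = Real.sqrt a + Real.sqrt b := Real.sqrt_sq hs

/-- **(R1)/(R2) shape.**  With `Q` a contraction, `Q ∘ T` `ε₁`-small, `U − T` `ηz`-small in the currency `N`, the dissipation floor
`N(Pu)² ≤ 2·q_T(Pu)` and the part-loss bound `q_T(Pu) ≤ q_T(u) + 2ε₁‖u‖²`:
`‖Q(U(Pu))‖ ≤ √(2ηz²·q_T(u)) + (ε₁ + 2ηz√ε₁)·‖u‖`. [folklore] -/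
theorem norm_low_transfer_le {U T Q : H → H} {N : H → ℝ} {ηz ε₁ : ℝ} (hηz : 0 ≤ ηz) (hε₁ : 0 ≤ ε₁)
    (hQlin : ∀ a b : H, Q (a + b) = Q a + Q b) (hQ : ∀ z, ‖Q z‖ ≤ ‖z‖) (hHi : ∀ y, ‖Q (T y)‖ ≤ ε₁ * ‖y‖)
    (hUT : ∀ x, ‖U x - T x‖ ≤ ηz * N x) (hT : ∀ y, ‖T y‖ ≤ ‖y‖)
    {u Pu : H} (hPu : ‖Pu‖ ≤ ‖u‖) (hNP : 0 ≤ N Pu) (hfloor : N Pu ^ 2 ≤ 2 * (‖Pu‖ ^ 2 - ‖T Pu‖ ^ 2))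
    (hpart : ‖Pu‖ ^ 2 - ‖T Pu‖ ^ 2 ≤ (‖u‖ ^ 2 - ‖T u‖ ^ 2) + 2 * ε₁ * ‖u‖ ^ 2) :
    ‖Q (U Pu)‖ ≤ Real.sqrt (2 * ηz ^ 2 * (‖u‖ ^ 2 - ‖T u‖ ^ 2)) + (ε₁ + 2 * ηz * Real.sqrt ε₁) * ‖u‖ := by
  set q : ℝ := ‖u‖ ^ 2 - ‖T u‖ ^ 2 with hq
  have hq0 : 0 ≤ q := by
    have := hT u; rw [hq]; nlinarith [norm_nonneg (T u), norm_nonneg u]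
  have hu0 : 0 ≤ ‖u‖ := norm_nonneg _
  -- step 1: triangle inequality through `T`
  have e : U Pu = T Pu + (U Pu - T Pu) := by abel
  have h1 : ‖Q (U Pu)‖ ≤ ε₁ * ‖u‖ + ηz * N Pu := by
    rw [e, hQlin]
    calc ‖Q (T Pu) + Q (U Pu - T Pu)‖ ≤ ‖Q (T Pu)‖ + ‖Q (U Pu - T Pu)‖ := norm_add_le _ _
      _ ≤ ε₁ * ‖Pu‖ + ηz * N Pu := add_le_add (hHi Pu) ((hQ _).trans (hUT Pu))
      _ ≤ ε₁ * ‖u‖ + ηz * N Pu := by nlinarith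
  -- step 2: `N Pu ≤ √(2(q + 2ε₁‖u‖²)) ≤ √(2q) + 2√ε₁‖u‖`
  have h2 : N Pu ≤ Real.sqrt (2 * q) + 2 * Real.sqrt ε₁ * ‖u‖ := by
    have hN2 : N Pu ^ 2 ≤ 2 * q + 4 * ε₁ * ‖u‖ ^ 2 := by nlinarith
    have hNle : N Pu ≤ Real.sqrt (2 * q + 4 * ε₁ * ‖u‖ ^ 2) := by
      rw [← Real.sqrt_sq hNP]; exact Real.sqrt_le_sqrt hN2
    have hsplit := sqrt_add_le' (a := 2 * q) (b := 4 * ε₁ * ‖u‖ ^ 2) (by positivity) (by positivity)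
    have h4 : Real.sqrt (4 * ε₁ * ‖u‖ ^ 2) = 2 * Real.sqrt ε₁ * ‖u‖ := by
      rw [show 4 * ε₁ * ‖u‖ ^ 2 = (2 * ‖u‖) ^ 2 * ε₁ by ring, Real.sqrt_mul (by positivity), Real.sqrt_sq (by positivity)]
      ring
    linarith
  -- step 3: assemble; `ηz·√(2q) = √(2ηz²q)`
  have h3 : ηz * Real.sqrt (2 * q) = Real.sqrt (2 * ηz ^ 2 * q) := by
    rw [show 2 * ηz ^ 2 * q = ηz ^ 2 * (2 * q) by ring, Real.sqrt_mul (sq_nonneg _), Real.sqrt_sq hηz]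
  calc ‖Q (U Pu)‖ ≤ ε₁ * ‖u‖ + ηz * N Pu := h1
    _ ≤ ε₁ * ‖u‖ + ηz * (Real.sqrt (2 * q) + 2 * Real.sqrt ε₁ * ‖u‖) := by nlinarith [mul_le_mul_of_nonneg_left h2 hηz]
    _ = Real.sqrt (2 * ηz ^ 2 * q) + (ε₁ + 2 * ηz * Real.sqrt ε₁) * ‖u‖ := by rw [← h3]; ring

/-- Repackaging of the (R1)/(R2) right-hand side in the §9d currency: with `ηz′ := 2ηz²`, `‖u‖ ≤ ‖x₁‖`, `ε₁ + 2ηz√ε₁ ≤ ε`: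
`√(2ηz²q) + (ε₁ + 2ηz√ε₁)‖u‖ ≤ √(ηz′·q) + ε‖x₁‖`. [folklore] -/
theorem low_transfer_currency {q ηz ε₁ ε nu nx : ℝ} (hηz : 0 ≤ ηz) (hε₁ : 0 ≤ ε₁) (hnu : 0 ≤ nu)
    (hux : nu ≤ nx) (hε : ε₁ + 2 * ηz * Real.sqrt ε₁ ≤ ε) :
    Real.sqrt (2 * ηz ^ 2 * q) + (ε₁ + 2 * ηz * Real.sqrt ε₁) * nu ≤ Real.sqrt ((2 * ηz ^ 2) * q) + ε * nx := by
  have h0 : 0 ≤ ε₁ + 2 * ηz * Real.sqrt ε₁ := by positivity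
  nlinarith [mul_le_mul hε hux hnu (h0.trans hε)]

/-- Repackaging of the (R3)–(R6) right-hand side: with `‖y‖ ≤ ‖x₁‖` and `ε₁ ≤ ε`: `ηz‖y‖ + ε₁‖y‖ ≤ ηz‖y‖ + ε‖x₁‖`. [folklore] -/
theorem high_transfer_currency {ηz ε₁ ε ny nx : ℝ} (hε₁ : 0 ≤ ε₁) (hny : 0 ≤ ny) (hyx : ny ≤ nx) (hε : ε₁ ≤ ε) :
    ηz * ny + ε₁ * ny ≤ ηz * ny + ε * nx := by
  nlinarith [mul_le_mul hε hyx hny (hε₁.trans hε)]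

end Summit.AnomalousDissipation.AnomalousDissipation.Theorems.SolenoidalFractalHomogenisation.LagrangianStep.Transfer

end
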